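import Summits.HubbardSuperconductivity.HubbardSuperconductivity.Theorems.LiebTwinDWavePolarisedDiscordanceLeakNonneg
import Summits.HubbardSuperconductivity.HubbardSuperconductivity.Theorems.LiebTwinDWavePolarisedDiscordanceStubChannelCompleteness
import HarnessLib

/-!
# Route `LiebTwin`, crux `DWavePolarisedDiscordance` (stmt-HubbardSuperconductivity-15314), line `Sketch`:
# the total zero-pair-momentum pair weight and its monotonicity under rectification (helper, `--supports`)

Second-quantised reading of the central quantity `Tr G = −4·Leak` of line `Sketch` (card
`Ideas/channel-exhaustion-sum-rule.md`). For the BARE relative-coordinate channel fields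
`Δ_r := Σ_x c_{x↑} c_{x+r,↓}` (`r ∈ (ℤ/L)²`; the tree's `pairField g L` is `√2 Σ_e g(e) Δ_e` for even `g`,
`LiebTwinDiscordance.pairField_eq_of_even`) and a sector vector `ψ` with Lieb matrix `W = liebW n ψ`:

* `expect_channelField_conjTranspose_mul_channelField` — `⟨ψ, Δ_rᴴ Δ_{r'} ψ⟩ = chan_{Wᴴ,W}(r, r')`
  `:= Σ_{x,x'} Tr(Wᴴ B_{x x'} W B_{x+r, x'+r'}ᵀ)` (`B_{uv} = configHop n u v`; Lieb transfer, termwise the landed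
  `LiebTwinDiscordance.star_dotProduct_hopPair_mulVec`);
* `sum_expect_channelField_eq` — the TOTAL zero-pair-momentum pair weight is a sum over rigid displacements:
  `Σ_r ⟨ψ, Δ_rᴴ Δ_r ψ⟩ = Σ_a Tr(Wᴴ 𝒯_a W 𝒯_aᵀ)`, `𝒯_a = Σ_x B_{x,x+a}` (conservation law `stub_channelCompleteness`, p163800)
  — i.e. `= L² Σ_k ⟨n_{k↑} n_{−k↓}⟩_ψ`, the Cooper-partner co-occupancy;
* `sum_expect_channelField_twin_sub` — for EVERY `(n,n)`-sector `φ`: `Σ_r ‖Δ_r φ̃‖² − Σ_r ‖Δ_r φ‖² = 4·Leak(φ)`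
  (`φ̃ = liebVec n |W|`; `4·Leak = Σ_a Re[Tr(|W|ᴴ𝒯_a|W|𝒯_aᵀ) − Tr(Wᴴ𝒯_aW𝒯_aᵀ)]`), so `Tr G = −4·Leak` verbatim;
* `sum_expect_channelField_le_twin_of_real` (= registered stub `stub_totalPairWeightMonotone`) — **Lieb rectification never
  decreases the total zero-pair-momentum pair weight**: for every real `(n,n)`-sector `φ` with `Wᵀ = ±W`,
  `Σ_r ‖Δ_r φ‖² ≤ Σ_r ‖Δ_r φ̃‖²` (`leak_nonneg_of_real`, p164144). The line's `stub_leakBound` asserts that along ground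
  states this increase, `4·Leak`, is at most `(η/8)·m + o(L⁴)`.

Sources: E. H. Lieb, PRL **62** (1989) 1201, eqs. (3)–(4) and proof of Theorem 1; C. N. Yang, PRL **63** (1989) 2144
(pair operators); G.-S. Tian, J. Phys. A **37** (2004) 2671. Finite-dimensional bookkeeping; no definition, no named fact.
-/

-- the mandated namespace `Summit.<Summit>.<Problem>.Theorems` repeats `HubbardSuperconductivity` (D-0017)
set_option linter.dupNamespace false

noncomputable section

namespace Summit.HubbardSuperconductivity.HubbardSuperconductivity.Theorems.LiebTwinChannelExhaustion

open Matrix Finset Literature.MathematicalPhysics.QuantumLattice Literature.Probability.LatticeModels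
open Summit.HubbardSuperconductivity.HubbardSuperconductivity.Theorems.LiebTwinDiscordance
  (pair_conjTranspose_mul_pair₄ star_dotProduct_hopPair_mulVec)
open scoped ComplexOrder MatrixOrder Matrix.Norms.L2Operator

variable {L : ℕ} [NeZero L]

omit [NeZero L] in
/-- **Lieb transfer of a product of bare channel fields.** For `ψ` in the `(n, n)` sector and torus sites
`x, y, x', y'`: `⟨ψ, (c_{x↑}c_{y↓})ᴴ (c_{x'↑}c_{y'↓}) ψ⟩ = Tr(Wᴴ B_{xx'} W B_{yy'}ᵀ)` (`W = liebW n ψ`, `B = configHop n`).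
Lieb, PRL 62 (1989) 1201, eqs. (3)–(4); Yang, PRL 63 (1989) 2144. [folklore] -/
theorem star_dotProduct_pair_conjTranspose_mul_pair_mulVec {n : ℕ} {ψ : Fock (Orb (FermionTorus 2 L))}
    (hψ : IsInSector n n ψ) (x y x' y' : FermionTorus 2 L) :
    star ψ ⬝ᵥ (((annihilation (orb x 0) * annihilation (orb y 1) :
        Matrix (Finset (Orb (FermionTorus 2 L))) (Finset (Orb (FermionTorus 2 L))) ℂ)ᴴ *
          (annihilation (orb x' 0) * annihilation (orb y' 1))) *ᵥ ψ) =
      ((liebW n ψ)ᴴ * (configHop n x x' * (liebW n ψ * (configHop n y y')ᵀ))).trace := by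
  rw [pair_conjTranspose_mul_pair₄, star_dotProduct_hopPair_mulVec hψ]

/-- **The channel kernel is a pair correlation.** For `ψ` in the `(n, n)` sector and relative coordinates `r, r'`:
`⟨ψ, Δ_rᴴ Δ_{r'} ψ⟩ = Σ_{x,x'} Tr(Wᴴ B_{x x'} W B_{x+r, x'+r'}ᵀ)`, `Δ_r = Σ_x c_{x↑} c_{x+r,↓}`.
Lieb, PRL 62 (1989) 1201; Scalapino, Phys. Rep. 250 (1995) 329, §2. [folklore] -/
theorem expect_channelField_conjTranspose_mul_channelField {n : ℕ} {ψ : Fock (Orb (FermionTorus 2 L))}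
    (hψ : IsInSector n n ψ) (r r' : TorusSite 2 L) :
    expect ((∑ x : TorusSite 2 L, annihilation (orb (FermionTorus.ofTorusSite x) 0) *
          annihilation (orb (FermionTorus.ofTorusSite (x + r)) 1))ᴴ *
        (∑ x' : TorusSite 2 L, annihilation (orb (FermionTorus.ofTorusSite x') 0) *
          annihilation (orb (FermionTorus.ofTorusSite (x' + r')) 1))) ψ =
      ∑ x : TorusSite 2 L, ∑ x' : TorusSite 2 L,
        ((liebW n ψ)ᴴ * configHop n (FermionTorus.ofTorusSite x) (FermionTorus.ofTorusSite x') * liebW n ψ *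
          (configHop n (FermionTorus.ofTorusSite (x + r)) (FermionTorus.ofTorusSite (x' + r')))ᵀ).trace := by
  rw [Literature.MathematicalPhysics.QuantumLattice.expect, conjTranspose_sum, Finset.sum_mul, Matrix.sum_mulVec,
    dotProduct_sum]
  refine Finset.sum_congr rfl fun x _ => ?_
  rw [Finset.mul_sum, Matrix.sum_mulVec, dotProduct_sum]
  refine Finset.sum_congr rfl fun x' _ => ?_
  rw [star_dotProduct_pair_conjTranspose_mul_pair_mulVec hψ]
  simp only [Matrix.mul_assoc]

/-- **The total zero-pair-momentum pair weight is a sum over rigid displacements**: for `ψ` in the `(n, n)` sector,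
`Σ_r ⟨ψ, Δ_rᴴ Δ_r ψ⟩ = Σ_a Tr(Wᴴ 𝒯_a W 𝒯_aᵀ)`, `𝒯_a = Σ_x B_{x, x+a}` (the conservation law `stub_channelCompleteness`;
in momentum space `𝒯_a = Σ_k e^{ik·a} n_k`, so this is `L² Σ_k ⟨n_{k↑} n_{−k↓}⟩_ψ`). Lieb, PRL 62 (1989) 1201. [folklore] -/
theorem sum_expect_channelField_eq {n : ℕ} {ψ : Fock (Orb (FermionTorus 2 L))} (hψ : IsInSector n n ψ) :
    ∑ r : TorusSite 2 L, expect ((∑ x : TorusSite 2 L, annihilation (orb (FermionTorus.ofTorusSite x) 0) *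
          annihilation (orb (FermionTorus.ofTorusSite (x + r)) 1))ᴴ *
        (∑ x' : TorusSite 2 L, annihilation (orb (FermionTorus.ofTorusSite x') 0) *
          annihilation (orb (FermionTorus.ofTorusSite (x' + r)) 1))) ψ =
      ∑ a : TorusSite 2 L,
        ((liebW n ψ)ᴴ *
            (∑ x : TorusSite 2 L, configHop n (FermionTorus.ofTorusSite x) (FermionTorus.ofTorusSite (x + a))) *
            liebW n ψ *
            (∑ x : TorusSite 2 L,
              configHop n (FermionTorus.ofTorusSite x) (FermionTorus.ofTorusSite (x + a)))ᵀ).trace := by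
  simp_rw [expect_channelField_conjTranspose_mul_channelField hψ]
  exact stub_channelCompleteness L n _ _

/-- **`Tr G = −4·Leak`, second-quantised**: for EVERY `(n, n)`-sector vector `φ` (no reality or symmetry of `W` needed),
`Σ_r ‖Δ_r φ̃‖² − Σ_r ‖Δ_r φ‖² = Σ_a Re[Tr(|W|ᴴ 𝒯_a |W| 𝒯_aᵀ) − Tr(Wᴴ 𝒯_a W 𝒯_aᵀ)]` (`= 4·Leak(φ)`), `φ̃ = liebVec n |W|`,
`W = liebW n φ`. Lieb, PRL 62 (1989) 1201. [folklore] -/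
theorem sum_expect_channelField_twin_sub {n : ℕ} {φ : Fock (Orb (FermionTorus 2 L))} (hφ : IsInSector n n φ) :
    (∑ r : TorusSite 2 L, expect ((∑ x : TorusSite 2 L, annihilation (orb (FermionTorus.ofTorusSite x) 0) *
          annihilation (orb (FermionTorus.ofTorusSite (x + r)) 1))ᴴ *
        (∑ x' : TorusSite 2 L, annihilation (orb (FermionTorus.ofTorusSite x') 0) *
          annihilation (orb (FermionTorus.ofTorusSite (x' + r)) 1))) (liebVec n (CFC.abs (liebW n φ)))).re -
      (∑ r : TorusSite 2 L, expect ((∑ x : TorusSite 2 L, annihilation (orb (FermionTorus.ofTorusSite x) 0) *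
          annihilation (orb (FermionTorus.ofTorusSite (x + r)) 1))ᴴ *
        (∑ x' : TorusSite 2 L, annihilation (orb (FermionTorus.ofTorusSite x') 0) *
          annihilation (orb (FermionTorus.ofTorusSite (x' + r)) 1))) φ).re =
      (∑ a : TorusSite 2 L,
        (((CFC.abs (liebW n φ))ᴴ *
              (∑ x : TorusSite 2 L, configHop n (FermionTorus.ofTorusSite x) (FermionTorus.ofTorusSite (x + a))) *
              CFC.abs (liebW n φ) *
              (∑ x : TorusSite 2 L,
                configHop n (FermionTorus.ofTorusSite x) (FermionTorus.ofTorusSite (x + a)))ᵀ).trace -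
          ((liebW n φ)ᴴ *
              (∑ x : TorusSite 2 L, configHop n (FermionTorus.ofTorusSite x) (FermionTorus.ofTorusSite (x + a))) *
              liebW n φ *
              (∑ x : TorusSite 2 L,
                configHop n (FermionTorus.ofTorusSite x) (FermionTorus.ofTorusSite (x + a)))ᵀ).trace)).re := by
  rw [sum_expect_channelField_eq hφ, sum_expect_channelField_eq (isInSector_liebVec n _), LiebThm1.liebW_liebVec,
    ← Complex.sub_re, ← Finset.sum_sub_distrib]

/-- **Rectification never decreases the total zero-pair-momentum pair weight** (real flip-definite vectors): for every
real `(n, n)`-sector `φ` of the torus with `Wᵀ = W` or `Wᵀ = −W` (`W = liebW n φ`),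
`Σ_r ‖Δ_r φ‖² ≤ Σ_r ‖Δ_r φ̃‖²`, `Δ_r = Σ_x c_{x↑}c_{x+r,↓}`, `φ̃ = liebVec n |W|`; the increase is `4·Leak(φ) ≥ 0`
(`leak_nonneg_of_real`). Lieb, PRL 62 (1989) 1201, proof of Theorem 1. [folklore] -/
theorem sum_expect_channelField_le_twin_of_real {n : ℕ} {φ : Fock (Orb (FermionTorus 2 L))}
    (hreal : ∀ s, star (φ s) = φ s) (hφ : IsInSector n n φ)
    (hflip : (liebW n φ)ᵀ = liebW n φ ∨ (liebW n φ)ᵀ = -liebW n φ) :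
    (∑ r : TorusSite 2 L, expect ((∑ x : TorusSite 2 L, annihilation (orb (FermionTorus.ofTorusSite x) 0) *
          annihilation (orb (FermionTorus.ofTorusSite (x + r)) 1))ᴴ *
        (∑ x' : TorusSite 2 L, annihilation (orb (FermionTorus.ofTorusSite x') 0) *
          annihilation (orb (FermionTorus.ofTorusSite (x' + r)) 1))) φ).re ≤
      (∑ r : TorusSite 2 L, expect ((∑ x : TorusSite 2 L, annihilation (orb (FermionTorus.ofTorusSite x) 0) *
          annihilation (orb (FermionTorus.ofTorusSite (x + r)) 1))ᴴ *
        (∑ x' : TorusSite 2 L, annihilation (orb (FermionTorus.ofTorusSite x') 0) *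
          annihilation (orb (FermionTorus.ofTorusSite (x' + r)) 1))) (liebVec n (CFC.abs (liebW n φ)))).re := by
  have h := leak_nonneg_of_real (n := n) hreal hflip
  rw [← sum_expect_channelField_twin_sub hφ] at h
  linarith

/-- **STUB `stub_totalPairWeightMonotone`** of crux `DWavePolarisedDiscordance` (stmt-HubbardSuperconductivity-15314), line `Sketch`
(route vocabulary, registered): for every real `(n,n)`-sector vector of the torus with flip-definite Lieb matrix, Lieb rectification
does not decrease the total zero-pair-momentum pair weight `Σ_r ⟨Δ_rᴴ Δ_r⟩`, `Δ_r = Σ_x c_{x↑} c_{x+r,↓}`. Lieb, PRL 62 (1989) 1201. [folklore] -/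
theorem stub_totalPairWeightMonotone :
    open Literature.MathematicalPhysics.QuantumLattice Literature.Probability.LatticeModels in
    open scoped MatrixOrder Matrix.Norms.L2Operator in
    ∀ (L : ℕ) [NeZero L] (n : ℕ) (φ : Fock (Orb (FermionTorus 2 L))), (∀ s, star (φ s) = φ s) → IsInSector n n φ →
      ((liebW n φ)ᵀ = liebW n φ ∨ (liebW n φ)ᵀ = -liebW n φ) →
        (∑ r : TorusSite 2 L, expect ((∑ x : TorusSite 2 L, annihilation (orb (FermionTorus.ofTorusSite x) 0) *
              annihilation (orb (FermionTorus.ofTorusSite (x + r)) 1))ᴴ *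
            (∑ x' : TorusSite 2 L, annihilation (orb (FermionTorus.ofTorusSite x') 0) *
              annihilation (orb (FermionTorus.ofTorusSite (x' + r)) 1))) φ).re ≤
          (∑ r : TorusSite 2 L, expect ((∑ x : TorusSite 2 L, annihilation (orb (FermionTorus.ofTorusSite x) 0) *
              annihilation (orb (FermionTorus.ofTorusSite (x + r)) 1))ᴴ *
            (∑ x' : TorusSite 2 L, annihilation (orb (FermionTorus.ofTorusSite x') 0) *
              annihilation (orb (FermionTorus.ofTorusSite (x' + r)) 1))) (liebVec n (CFC.abs (liebW n φ)))).re :=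
  fun _ _ _ _ hreal hφ hflip => sum_expect_channelField_le_twin_of_real hreal hφ hflip

end Summit.HubbardSuperconductivity.HubbardSuperconductivity.Theorems.LiebTwinChannelExhaustion

end
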